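import Literature.Combinatorics.Optimization.QuadraticKernelNonnegativeRank
import Literature.Barriers.PneNP.TSPExtensionComplexityFactorization
import Literature.LinearAlgebra.Matrix.PerronSymmetric
import HarnessLib

/-!
# Fawzi 2021, Theorem 1: polytopes sandwiched between `(1-ε)(D - A)` and `D - A` have extension complexity `≥ e^{c√n}`

H. Fawzi, *On polyhedral approximations of the positive semidefinite cone*, Math. Oper. Res. 46
(2021) 1479–1489 = arXiv:1811.09649 [Fawzi2021].  `D = {X ∈ S^n_+ : Tr X = 1}` is the set of
density matrices ("also known as the set of density matrices", p. 3).

**Theorem 1** (p. 3, verbatim): "For any `0 < ε < 1`, there exists a constant `c > 0` such that the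
following is true. Let `A` be an `n×n` real symmetric matrix of trace equal to one. If `P` is a polytope
such that `(1-ε)(D-A) ⊂ P ⊂ D-A` then the extension complexity of `P` is at least `e^{c√n}`."

This file PROVES it (`Fawzi2021_thm1`), in the tree's extension-complexity currency
`Literature.Barriers.PneNP.HasEFOfSize P r` (a slack-form system with `r` inequalities projecting
exactly onto `P ⊆ ℝ^{n×n}`; every polytope has one, `hasEFOfSize_convexHull_finset`), with matrices
flattened to `Fin n × Fin n → ℝ` (`vec`, `mat`) and `D = denSet n`.  Rendering decisions:
* "for all `n`" is rendered "for all `n ≥ n₀(ε)`" (for `n = 1`, `D - A = {0}` is a point, whose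
  extension complexity is `0 < e^{c}`; the printed constant cannot absorb small `n`) — the same reading
  as the tree's `Rothvoss2017_thm1`;
* `P` ranges over all subsets with an extended formulation (these are exactly the polyhedra that are
  projections of slack-form systems; the printed `P` is a polytope, and `P ⊆ D - A` is bounded anyway).

THE PROOF.  §2.2 Theorem 4 (generalized Yannakakis, lower-bound direction) is the tree's
`HasEFOfSize.exists_nonneg_factorisation`: points of `P` and inequalities valid on `P` have a slack
matrix that factors through `r + 1` nonnegative terms.  §3 *Reduction to `A = I/n`* + *Slack matrix*:
DEVIATION (a shorter road, recorded): instead of Aubrun's rotation-and-cyclic-averaging argument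
(`xc` of a Minkowski average), we take the hypercube IN AN ORTHONORMAL EIGENBASIS `u₁,…,u_n` OF `A`:
`x_s = n^{-1/2} ∑ᵢ σ(sᵢ) uᵢ` (`s ∈ {0,1}^n`).  Then `‖x_s‖ = 1`, `x_sᵀ x_t = σ_sᵀσ_t/n`, and
`x_tᵀ A x_t = (∑ᵢ λᵢ)/n = Tr A/n = 1/n`; the points `(1-ε)(x_s x_sᵀ - A) ∈ (1-ε)(D - A) ⊆ P` and the
inequalities `⟨I - n x_t x_tᵀ, Z⟩ ≤ 1`, valid on `D - A ⊇ P` (`= n x_tᵀ A x_t - n x_tᵀ X x_t ≤ 1`),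
have slack EXACTLY `ε + (1-ε)(σ_sᵀσ_t)²/n` — the matrix (3.3) of the paper
(`Fawzi2021.quadKernel`, "`1 - ⟨(1-ε)(xxᵀ - I/n), I - n yyᵀ⟩ = (1-ε) n (xᵀy)² + ε`").  Hence an EF
of size `r` gives a nonnegative factorization of (3.3) of size `r + 1`, and
`Fawzi2021.quadKernel_nonnegRank` (file `QuadraticKernelNonnegativeRank.lean`, the hypercontractivity
argument of §3) gives `r + 1 ≥ e^{c₀√n}`, so `r ≥ e^{(c₀/2)√n}` for large `n`.

NOT typed here: Theorem 2 (Gaussian-width version, `e^{c n^{1/3}}`; its proof needs the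
concentration of `λ_max` of a GOE matrix, Lemma 5, absent from the tree; no consumer) and the remarks
on the elliptope.  No named facts; definitions `vec`, `mat`, `denSet`, `cubeVec` with unfolding lemmas.
-/

noncomputable section

namespace Literature.Combinatorics.Optimization

namespace Fawzi2021

open Finset Matrix Real
open scoped Pointwise
open Literature.Probability.RandomGraphs.LowDegree (sgn sgn_mul_self)
open Literature.Barriers.PneNP (HasEFOfSize)

variable {n : ℕ}

/-! ### Matrices as vectors of `ℝ^{n×n}` -/

/-- Flattening of an `n×n` matrix to a vector indexed by `Fin n × Fin n` (the natural coordinates of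
the polytopes of Theorem 1). [cite: Fawzi2021, §1 (p. 3: polytopes `P ⊂ D - A` in the space of symmetric matrices)] -/
def vec (M : Matrix (Fin n) (Fin n) ℝ) : Fin n × Fin n → ℝ := fun p => M p.1 p.2

/-- Unflattening. [cite: Fawzi2021, §1 (p. 3)] -/
def mat (X : Fin n × Fin n → ℝ) : Matrix (Fin n) (Fin n) ℝ := Matrix.of fun i j => X (i, j)

/-- `mat ∘ vec = id`. [cite: Fawzi2021, §1 (p. 3)] -/
@[simp] theorem mat_vec (M : Matrix (Fin n) (Fin n) ℝ) : mat (vec M) = M := by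
  ext i j; rfl

/-- `vec ∘ mat = id`. [cite: Fawzi2021, §1 (p. 3)] -/
@[simp] theorem vec_mat (X : Fin n × Fin n → ℝ) : vec (mat X) = X := by
  funext p; rfl

/-- `vec` is additive (subtraction). [cite: Fawzi2021, §1 (p. 3)] -/
theorem vec_sub (M N : Matrix (Fin n) (Fin n) ℝ) : vec (M - N) = vec M - vec N := rfl

/-- `vec` is homogeneous. [cite: Fawzi2021, §1 (p. 3)] -/
theorem vec_smul (c : ℝ) (M : Matrix (Fin n) (Fin n) ℝ) : vec (c • M) = c • vec M := rfl

/-- The Frobenius pairing in flattened coordinates: `vec M · X = ∑ᵢⱼ Mᵢⱼ Xᵢⱼ`.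
[cite: Fawzi2021, §2.2 (p. 5: `S_{K,L}(x,y) = 1 - ⟨x, y⟩`)] -/
theorem vec_dotProduct (M : Matrix (Fin n) (Fin n) ℝ) (X : Fin n × Fin n → ℝ) :
    vec M ⬝ᵥ X = ∑ i, ∑ j, M i j * X (i, j) := by
  unfold vec dotProduct
  rw [Fintype.sum_prod_type]

/-- `⟨I, B⟩ = Tr B`. [cite: Fawzi2021, §3 (p. 6, slack computation)] -/
theorem vec_one_dotProduct_vec (B : Matrix (Fin n) (Fin n) ℝ) :
    vec (1 : Matrix (Fin n) (Fin n) ℝ) ⬝ᵥ vec B = B.trace := by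
  rw [vec_dotProduct, Matrix.trace]
  refine sum_congr rfl fun i _ => ?_
  unfold vec
  simp only [Matrix.diag]
  rw [sum_eq_single i]
  · simp
  · intro j _ hji
    rw [Matrix.one_apply_ne (Ne.symm hji), zero_mul]
  · intro h; exact absurd (mem_univ i) h

/-- `⟨y yᵀ, B⟩ = yᵀ B y`. [cite: Fawzi2021, §3 (p. 6, slack computation)] -/
theorem vec_vecMulVec_dotProduct_vec (y : Fin n → ℝ) (B : Matrix (Fin n) (Fin n) ℝ) :
    vec (vecMulVec y y) ⬝ᵥ vec B = y ⬝ᵥ (B *ᵥ y) := by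
  rw [vec_dotProduct]
  unfold vec dotProduct mulVec dotProduct
  simp only [vecMulVec_apply]
  refine sum_congr rfl fun i _ => ?_
  rw [mul_sum]
  exact sum_congr rfl fun j _ => by ring

/-- `yᵀ (x xᵀ) y = (xᵀy)²`. [cite: Fawzi2021, §3 (p. 6: "`⟨xxᵀ, yyᵀ⟩`-term `(xᵀy)²`")] -/
theorem dotProduct_vecMulVec_mulVec (x y : Fin n → ℝ) :
    y ⬝ᵥ (vecMulVec x x *ᵥ y) = (x ⬝ᵥ y) ^ 2 := by
  unfold dotProduct mulVec dotProduct
  simp only [vecMulVec_apply]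
  rw [sq, sum_mul_sum]
  refine sum_congr rfl fun i _ => ?_
  rw [mul_sum]
  exact sum_congr rfl fun j _ => by ring

/-! ### The set of density matrices -/

/-- **The set of density matrices** `D = {X ∈ S^n_+ : Tr(X) = 1}`, as a subset of `ℝ^{n×n}`.
[cite: Fawzi2021, §1 (p. 3: "`D = {X ∈ S^n_+, Tr(X) = 1} = conv{xxᵀ : ‖x‖₂ = 1}`")] -/
def denSet (n : ℕ) : Set (Fin n × Fin n → ℝ) := {X | (mat X).PosSemidef ∧ (mat X).trace = 1}

/-- Membership in `D`, unfolded. [cite: Fawzi2021, §1 (p. 3)] -/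
theorem mem_denSet {X : Fin n × Fin n → ℝ} : X ∈ denSet n ↔ (mat X).PosSemidef ∧ (mat X).trace = 1 :=
  Iff.rfl

/-- Pure states are density matrices: `x xᵀ ∈ D` for a unit vector `x`.
[cite: Fawzi2021, §1 (p. 3: "`D = conv{xxᵀ : x ∈ ℝ^n, ‖x‖₂ = 1}`")] -/
theorem vec_vecMulVec_mem_denSet {x : Fin n → ℝ} (hx : x ⬝ᵥ x = 1) :
    vec (vecMulVec x x) ∈ denSet n := by
  refine ⟨?_, ?_⟩
  · rw [mat_vec]
    simpa using posSemidef_vecMulVec_self_star x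
  · rw [mat_vec, trace_vecMulVec, hx]

/-! ### The hypercube in an eigenbasis of `A` -/

section Eigenbasis

variable {A : Matrix (Fin n) (Fin n) ℝ}

/-- The hypercube point `x_s = n^{-1/2} ∑ᵢ σ(sᵢ) uᵢ` in an orthonormal eigenbasis `(uᵢ)` of `A`
(for `A = I/n` and the standard basis this is the printed `x ∈ {-1/√n, +1/√n}^n`).
[cite: Fawzi2021, §3 (p. 6: "the submatrix indexed by elements of the hypercube `{-1/√n, +1/√n}^n`")] -/
def cubeVec (hA : A.IsHermitian) (s : Fin n → Bool) : Fin n → ℝ :=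
  (Real.sqrt n)⁻¹ • ∑ i, sgn (s i) • ⇑(hA.eigenvectorBasis i)

/-- Dot products of eigenbasis expansions: `(∑ aᵢuᵢ)ᵀ(∑ bⱼuⱼ) = ∑ aᵢbᵢ`. [cite: Fawzi2021, §3 (p. 6)] -/
theorem sum_smul_dotProduct_sum_smul (hA : A.IsHermitian) (a b : Fin n → ℝ) :
    (∑ i, a i • ⇑(hA.eigenvectorBasis i)) ⬝ᵥ (∑ j, b j • ⇑(hA.eigenvectorBasis j)) = ∑ i, a i * b i := by
  rw [sum_dotProduct]
  refine sum_congr rfl fun i _ => ?_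
  rw [dotProduct_sum]
  simp_rw [smul_dotProduct, dotProduct_smul, smul_eq_mul]
  have horth : ∀ j, ⇑(hA.eigenvectorBasis i) ⬝ᵥ ⇑(hA.eigenvectorBasis j) = if i = j then (1 : ℝ) else 0 := by
    intro j
    exact Literature.LinearAlgebra.Matrix.eigenvectorBasis_dotProduct hA i j
  simp_rw [horth, mul_ite, mul_one, mul_zero]
  rw [sum_ite_eq]; simp

/-- The quadratic form of `A` on eigenbasis expansions: `(∑ aᵢuᵢ)ᵀ A (∑ bⱼuⱼ) = ∑ λᵢ aᵢ bᵢ`.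
[cite: Fawzi2021, §3 (p. 6)] -/
theorem sum_smul_dotProduct_mulVec_sum_smul (hA : A.IsHermitian) (a b : Fin n → ℝ) :
    (∑ i, a i • ⇑(hA.eigenvectorBasis i)) ⬝ᵥ (A *ᵥ ∑ j, b j • ⇑(hA.eigenvectorBasis j)) =
      ∑ i, hA.eigenvalues i * (a i * b i) := by
  rw [mulVec_sum]
  simp_rw [mulVec_smul, hA.mulVec_eigenvectorBasis, smul_smul]
  rw [sum_smul_dotProduct_sum_smul hA]
  exact sum_congr rfl fun i _ => by ring

/-- `x_sᵀ x_t = σ_sᵀσ_t / n`. [cite: Fawzi2021, §3 (p. 6: the `(xᵀy)²` term with `x,y ∈ {±1/√n}^n`)] -/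
theorem cubeVec_dotProduct (hA : A.IsHermitian) (hn : 1 ≤ n) (s t : Fin n → Bool) :
    cubeVec hA s ⬝ᵥ cubeVec hA t = ip s t / n := by
  unfold cubeVec ip
  rw [smul_dotProduct, dotProduct_smul, sum_smul_dotProduct_sum_smul hA, smul_eq_mul, smul_eq_mul]
  have hnpos : (0 : ℝ) < n := by exact_mod_cast hn
  have hsq : Real.sqrt (n : ℝ) ^ 2 = n := Real.sq_sqrt hnpos.le
  have hs0 : Real.sqrt (n : ℝ) ≠ 0 := (Real.sqrt_pos.2 hnpos).ne'
  field_simp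
  rw [hsq]; ring

/-- `‖x_s‖² = 1`. [cite: Fawzi2021, §3 (p. 6: "`x ∈ S^{n-1}`")] -/
theorem cubeVec_dotProduct_self (hA : A.IsHermitian) (hn : 1 ≤ n) (s : Fin n → Bool) :
    cubeVec hA s ⬝ᵥ cubeVec hA s = 1 := by
  rw [cubeVec_dotProduct hA hn, ip_self]
  have hnpos : (0 : ℝ) < n := by exact_mod_cast hn
  exact div_self hnpos.ne'

/-- `x_tᵀ A x_t = Tr(A)/n` (`= 1/n` for a trace-one `A`): the identity behind the reduction to
`A = I/n` — here obtained by choosing the hypercube in an eigenbasis of `A` instead of the printed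
cyclic averaging. [cite: Fawzi2021, §3 (p. 6, "Reduction to the case `A = I/n`")] -/
theorem cubeVec_dotProduct_mulVec (hA : A.IsHermitian) (hn : 1 ≤ n) (t : Fin n → Bool) :
    cubeVec hA t ⬝ᵥ (A *ᵥ cubeVec hA t) = A.trace / n := by
  unfold cubeVec
  rw [mulVec_smul, smul_dotProduct, dotProduct_smul, sum_smul_dotProduct_mulVec_sum_smul hA, smul_eq_mul,
    smul_eq_mul]
  simp_rw [sgn_mul_self, mul_one]
  rw [hA.trace_eq_sum_eigenvalues]
  have hnpos : (0 : ℝ) < n := by exact_mod_cast hn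
  have hsq : Real.sqrt (n : ℝ) ^ 2 = n := Real.sq_sqrt hnpos.le
  have hs0 : Real.sqrt (n : ℝ) ≠ 0 := (Real.sqrt_pos.2 hnpos).ne'
  simp only [RCLike.ofReal_real_eq_id, id_eq]
  field_simp
  rw [hsq]; ring

end Eigenbasis

/-! ### The slack of the sandwiched pair on the rotated hypercube -/

section Slack

variable {A : Matrix (Fin n) (Fin n) ℝ}

/-- The test matrices `I - n x_t x_tᵀ` (extreme points of the polar `C° = -nC` of `C = D - I/n`).
[cite: Fawzi2021, §3 (p. 6: "its extreme points are `I_n - n yyᵀ` where `y ∈ S^{n-1}`")] -/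
def testVec (hA : A.IsHermitian) (t : Fin n → Bool) : Fin n × Fin n → ℝ :=
  vec ((1 : Matrix (Fin n) (Fin n) ℝ) - (n : ℝ) • vecMulVec (cubeVec hA t) (cubeVec hA t))

/-- The hypercube points of `(1-ε)(D - A)`: `(1-ε)(x_s x_sᵀ - A)`.
[cite: Fawzi2021, §3 (p. 6: "The extreme points of `C` are the `xxᵀ - I/n` where `x ∈ S^{n-1}`")] -/
def pointVec (hA : A.IsHermitian) (ε : ℝ) (s : Fin n → Bool) : Fin n × Fin n → ℝ :=
  (1 - ε) • (vec (vecMulVec (cubeVec hA s) (cubeVec hA s)) - vec A)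

/-- The pairing of a test matrix with a shifted matrix: `⟨I - n x_t x_tᵀ, X - A⟩ =
Tr X - Tr A - n x_tᵀ X x_t + n x_tᵀ A x_t`. [cite: Fawzi2021, §3 (p. 6, slack computation)] -/
theorem testVec_dotProduct_sub (hA : A.IsHermitian) (t : Fin n → Bool) (X : Fin n × Fin n → ℝ) :
    testVec hA t ⬝ᵥ (X - vec A) =
      (mat X).trace - A.trace - (n : ℝ) * (cubeVec hA t ⬝ᵥ (mat X *ᵥ cubeVec hA t)) +
        (n : ℝ) * (cubeVec hA t ⬝ᵥ (A *ᵥ cubeVec hA t)) := by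
  unfold testVec
  conv_lhs => rw [← vec_mat X]
  rw [vec_sub, vec_smul, ← vec_sub, sub_dotProduct, smul_dotProduct, vec_sub, dotProduct_sub,
    dotProduct_sub, vec_one_dotProduct_vec, vec_one_dotProduct_vec, vec_vecMulVec_dotProduct_vec,
    vec_vecMulVec_dotProduct_vec, smul_eq_mul]
  ring

/-- **Validity**: `⟨I - n x_t x_tᵀ, Z⟩ ≤ 1` for every `Z ∈ D - A` (it equals `1 - n x_tᵀ X x_t` with
`X ⪰ 0`, using `Tr A = 1` and `x_tᵀ A x_t = 1/n`). [cite: Fawzi2021, §3 (p. 6: "`C° = -nC`")] -/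
theorem testVec_dotProduct_le (hA : A.IsHermitian) (htr : A.trace = 1) (hn : 1 ≤ n) (t : Fin n → Bool)
    {Z : Fin n × Fin n → ℝ} (hZ : Z ∈ denSet n - {vec A}) : testVec hA t ⬝ᵥ Z ≤ 1 := by
  obtain ⟨X, hX, B, hB, rfl⟩ := Set.mem_sub.1 hZ
  rw [Set.mem_singleton_iff] at hB
  subst hB
  have hnpos : (0 : ℝ) < n := by exact_mod_cast hn
  rw [testVec_dotProduct_sub, cubeVec_dotProduct_mulVec hA hn, htr, hX.2, div_eq_mul_inv, one_mul,
    mul_inv_cancel₀ hnpos.ne']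
  have hpsd : 0 ≤ cubeVec hA t ⬝ᵥ (mat X *ᵥ cubeVec hA t) := by
    have := hX.1.dotProduct_mulVec_nonneg (cubeVec hA t)
    simpa using this
  nlinarith

/-- **The points lie in `(1-ε)(D - A)`**. [cite: Fawzi2021, §3 (p. 6)] -/
theorem pointVec_mem (hA : A.IsHermitian) (hn : 1 ≤ n) (ε : ℝ) (s : Fin n → Bool) :
    pointVec hA ε s ∈ (1 - ε) • (denSet n - {vec A}) := by
  unfold pointVec
  exact Set.smul_mem_smul_set (Set.sub_mem_sub (vec_vecMulVec_mem_denSet (cubeVec_dotProduct_self hA hn s))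
    (Set.mem_singleton _))

/-- **The slack is the hypercube kernel (3.3)**: `1 - ⟨I - n x_t x_tᵀ, (1-ε)(x_s x_sᵀ - A)⟩ =
(1-ε)(σ_sᵀσ_t)²/n + ε` ("`1 - ⟨(1-ε)(xxᵀ - I/n), I - n yyᵀ⟩ = (1-ε) n (xᵀy)² + ε`").
[cite: Fawzi2021, §3 eq. (3.2)–(3.3) (p. 6)] -/
theorem one_sub_testVec_dotProduct_pointVec (hA : A.IsHermitian) (htr : A.trace = 1) (hn : 1 ≤ n)
    (ε : ℝ) (s t : Fin n → Bool) :
    1 - testVec hA t ⬝ᵥ pointVec hA ε s = quadKernel n ε s t := by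
  have hnpos : (0 : ℝ) < n := by exact_mod_cast hn
  unfold pointVec
  rw [dotProduct_smul, smul_eq_mul, testVec_dotProduct_sub, mat_vec, trace_vecMulVec,
    cubeVec_dotProduct_self hA hn, cubeVec_dotProduct_mulVec hA hn, htr, dotProduct_vecMulVec_mulVec,
    cubeVec_dotProduct hA hn, quadKernel_apply, div_eq_mul_inv (1 : ℝ), one_mul, mul_inv_cancel₀ hnpos.ne']
  field_simp
  ring

/-- **Generalized Yannakakis on the rotated hypercube**: an extended formulation of size `r` of any
`P` with `(1-ε)(D - A) ⊆ P ⊆ D - A` yields a nonnegative factorization of the kernel (3.3) of size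
`r + 1`. [cite: Fawzi2021, Thm. 4 (§2.2, p. 5) and §3 (p. 6)] -/
theorem hasNonnegFactorization_quadKernel_of_hasEF (hA : A.IsHermitian) (htr : A.trace = 1)
    (hn : 1 ≤ n) {ε : ℝ}
    {P : Set (Fin n × Fin n → ℝ)} (hin : (1 - ε) • (denSet n - {vec A}) ⊆ P)
    (hout : P ⊆ denSet n - {vec A}) {r : ℕ} (hP : HasEFOfSize P r) :
    HasNonnegFactorization (quadKernel n ε) (r + 1) := by
  obtain ⟨U, V, hU, hV, hfac⟩ := hP.exists_nonneg_factorisation (A := Fin n → Bool) (B := Fin n → Bool)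
    (fun s => pointVec hA ε s) (fun s => hin (pointVec_mem hA hn ε s)) (fun t => testVec hA t)
    (fun _ => 1) (fun t Z hZ => testVec_dotProduct_le hA htr hn t (hout hZ))
  refine ⟨fun s l => V (finSuccEquiv r l) s, fun l t => U t (finSuccEquiv r l), fun s l => hV _ _,
    fun l t => hU _ _, fun s t => ?_⟩
  simp only
  rw [← one_sub_testVec_dotProduct_pointVec hA htr hn ε s t, hfac t s]
  exact (Fintype.sum_equiv (finSuccEquiv r) (fun l => V (finSuccEquiv r l) s * U t (finSuccEquiv r l))
    (fun l => U t l * V l s) fun l => by ring).symm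

end Slack

/-! ### Theorem 1 -/

/-- **Fawzi 2021, Theorem 1.**  "For any `0 < ε < 1`, there exists a constant `c > 0` such that the
following is true. Let `A` be an `n×n` real symmetric matrix of trace equal to one. If `P` is a
polytope such that `(1-ε)(D-A) ⊂ P ⊂ D-A` then the extension complexity of `P` is at least
`e^{c√n}`."  Here: for all `n ≥ n₀(ε)` (see the module docstring), for every `P ⊆ ℝ^{n×n}` with
`(1-ε) • (D - {A}) ⊆ P ⊆ D - {A}` and every slack-form extended formulation of `P` with `r`
inequalities, `e^{c√n} ≤ r`.  Proof: §2.2 Thm. 4 + the hypercube slack submatrix (3.3) in an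
eigenbasis of `A` + the hypercontractivity bound `Fawzi2021.quadKernel_nonnegRank`.
[cite: Fawzi2021, Thm. 1 (p. 3); proof §3 (pp. 6–7)] -/
theorem _root_.Literature.Combinatorics.Optimization.Fawzi2021_thm1 {ε : ℝ} (hε0 : 0 < ε) (hε1 : ε < 1) :
    ∃ c : ℝ, 0 < c ∧ ∃ n₀ : ℕ, ∀ n : ℕ, n₀ ≤ n →
      ∀ A : Matrix (Fin n) (Fin n) ℝ, A.IsSymm → A.trace = 1 →
      ∀ P : Set (Fin n × Fin n → ℝ),
        (1 - ε) • (denSet n - {vec A}) ⊆ P → P ⊆ denSet n - {vec A} →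
        ∀ r : ℕ, HasEFOfSize P r → Real.exp (c * Real.sqrt n) ≤ r := by
  obtain ⟨c₀, hc₀, n₀, hmain⟩ := quadKernel_nonnegRank hε0 hε1
  refine ⟨c₀ / 2, by positivity, max n₀ (max 1 ⌈(2 / c₀) ^ 2⌉₊), fun n hn A hsymm htr P hin hout r hP => ?_⟩
  have hn₀ : n₀ ≤ n := le_trans (le_max_left _ _) hn
  have hn1 : 1 ≤ n := le_trans (le_max_left _ _) ((le_max_right _ _).trans hn)
  have hnc : (2 / c₀) ^ 2 ≤ (n : ℝ) :=
    (Nat.le_ceil _).trans (by exact_mod_cast (le_max_right _ _).trans ((le_max_right _ _).trans hn))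
  have hA : A.IsHermitian := Matrix.isHermitian_iff_isSymm.2 hsymm
  have hfac := hasNonnegFactorization_quadKernel_of_hasEF hA htr hn1 hin hout hP
  have h1 := hmain n hn₀ (r + 1) hfac
  push_cast at h1
  -- `e^{c₀√n} ≥ 2 e^{(c₀/2)√n}` and `E² ≤ r + 1 ⇒ E ≤ r` for `E ≥ 2`
  set E : ℝ := Real.exp (c₀ / 2 * Real.sqrt n) with hE
  have hsqrt : 2 / c₀ ≤ Real.sqrt n := by
    rw [← Real.sqrt_sq (div_pos two_pos hc₀).le]
    exact Real.sqrt_le_sqrt hnc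
  have hE2 : 2 ≤ E := by
    have h2 : 2 ≤ Real.sqrt n * c₀ := (div_le_iff₀ hc₀).1 hsqrt
    have h3 : (1 : ℝ) ≤ c₀ / 2 * Real.sqrt n := by
      have : c₀ / 2 * Real.sqrt n = Real.sqrt n * c₀ / 2 := by ring
      rw [this]; linarith
    have h4 : (2 : ℝ) ≤ c₀ / 2 * Real.sqrt n + 1 := by linarith
    exact h4.trans (Real.add_one_le_exp _)
  have hEE : Real.exp (c₀ * Real.sqrt n) = E * E := by
    rw [hE, ← Real.exp_add]; congr 1; ring
  rw [hEE] at h1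
  nlinarith

end Fawzi2021

end Literature.Combinatorics.Optimization

end
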